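import Summits.Ventures.LatticeQCDFlow.Scoring.LagProductCovariance
import Summits.Ventures.LatticeQCDFlow.Scoring.CalibrationTruths

/-!
# `τ_int(Q²)` versus `τ_int(Q)` in the Gaussian model: the squared observable has autocorrelation `ρ²`, so `½ τ_int(Q) ≤ τ_int(Q²) ≤ τ_int(Q)` on C-1 and `τ_int(Q²) ≤ τ_int(Q)` whenever `0 ≤ ρ ≤ 1`

HONEST FRAMING: exact (Metropolis-corrected) sampling algorithms for lattice gauge theory;
figures of merit are autocorrelation/cost numbers at stated couplings and volumes; no
continuum-physics claim.

Venture `LatticeQCDFlow` (cell pub-lqcd), sub-topic `Scoring`; FANOUT row 16 (`su2-base`), GEN-8.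
NEW WORK of the cell over GEN-6's `Scoring/LagProductCovariance` (`IsWickFamily`: Wick / Isserlis
second and fourth moments, `covariance_mul_mul`) and row 11's `Scoring/CalibrationTruths` (`tauInt`,
`tauInt_geometric`); no definition; nothing cited as a fact.

Row 16 reports BOTH `τ_int(Q)` and `τ_int(Q²)` (the topological charge and its square, FANOUT row 16 /
CARD §3: at fine spacing `Q` is near-frozen and `Q²` is the susceptibility channel); the scorers treat
them as two observables.  In the Gaussian (Wick) model of the chain the two are tied exactly:

* **`IsWickFamily.covariance_sq`** — `cov[X_i², X_j²] = 2 C(i,j)²`; **`IsWickFamily.acf_sq`** — for a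
  stationary covariance `C(i,j) = σ² ρ(|j−i|)` with `ρ(0) = 1`, the normalised autocorrelation of the
  SQUARED observable at lag `t` is `ρ(t)²`.
* **`tauInt_sq_le`** — if `0 ≤ ρ ≤ 1` and `ρ` is summable then `τ_int(ρ²) ≤ τ_int(ρ)`: in the Gaussian
  model the squared observable never decorrelates more slowly than the observable.
* **`tauInt_sq_geometric`**, **`half_tauInt_le_tauInt_sq_geometric`** — on C-1 (`ρ(t) = r^t`,
  `0 ≤ r < 1`): `τ_int(ρ²) = (1 + r²)/(2(1 − r²))` and `½ τ_int(ρ) ≤ τ_int(ρ²) ≤ τ_int(ρ)`, the ratio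
  `τ_int(ρ²)/τ_int(ρ) = (1 + r²)/(1 + r)²` running from `1` (`r = 0`) down to `½` (`r → 1`): a CSD
  exponent read off `Q²` equals the one read off `Q` in this model (same divergence rate), while the
  PREFACTOR halves in the critical limit.

NOT CLAIMED: anything for non-Gaussian chains (for the frozen, integer-valued `Q` of fine lattices the
Wick model is only a caricature — said plainly); a lower bound `τ_int(ρ²) ≥ ½ τ_int(ρ)` beyond C-1
(false in general); numbers of ours.
-/

noncomputable section

open MeasureTheory ProbabilityTheory Filter Finset
open scoped Topology

namespace Summit.Ventures.LatticeQCDFlow.Scoring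

/-! ## §1 The squared observable of a Wick family -/

namespace IsWickFamily

variable {Ω : Type*} [MeasurableSpace Ω] {μ : Measure Ω} [IsProbabilityMeasure μ]
variable {X : ℕ → Ω → ℝ} {C : ℕ → ℕ → ℝ}

/-- **`cov[X_i², X_j²] = 2 C(i,j)²`** (Isserlis). -/
theorem covariance_sq (h : IsWickFamily X C μ) (i j : ℕ) :
    cov[fun ω => X i ω ^ 2, fun ω => X j ω ^ 2; μ] = 2 * C i j ^ 2 := by
  have e : ∀ k, (fun ω => X k ω ^ 2) = fun ω => X k ω * X k ω := fun k => funext fun ω => sq _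
  rw [e i, e j, h.covariance_mul_mul i i j j]
  ring

/-- `Var[X_i²] = 2 C(i,i)²`. -/
theorem variance_sq (h : IsWickFamily X C μ) (i : ℕ) :
    Var[fun ω => X i ω ^ 2; μ] = 2 * C i i ^ 2 := by
  have e : (fun ω => X i ω ^ 2) = fun ω => X i ω * X i ω := funext fun ω => sq _
  rw [e, h.variance_mul i i]
  ring

/-- **The autocorrelation of the squared observable is `ρ²`**: for a stationary covariance
`C(i,j) = σ² ρ(j − i)` (`i ≤ j`, `ρ(0) = 1`, `σ² ≠ 0`),
`cov[X_i², X_{i+t}²] / Var[X_i²] = ρ(t)²`. -/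
theorem acf_sq (h : IsWickFamily X C μ) {σ2 : ℝ} {ρ : ℕ → ℝ} (hσ : σ2 ≠ 0) (h0 : ρ 0 = 1)
    (hC : ∀ i t, C i (i + t) = σ2 * ρ t) (i t : ℕ) :
    cov[fun ω => X i ω ^ 2, fun ω => X (i + t) ω ^ 2; μ] / Var[fun ω => X i ω ^ 2; μ] = ρ t ^ 2 := by
  rw [h.covariance_sq, h.variance_sq]
  have hii : C i i = σ2 := by simpa only [add_zero, h0, mul_one] using hC i 0
  rw [hC i t, hii]
  field_simp

end IsWickFamily

/-! ## §2 `τ_int(ρ²) ≤ τ_int(ρ)` for `0 ≤ ρ ≤ 1` -/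

section Compare

/-- If `0 ≤ ρ ≤ 1` and `ρ` is summable then `ρ²` is summable. -/
theorem summable_sq_of_nonneg_le_one {ρ : ℕ → ℝ} (h0 : ∀ t, 0 ≤ ρ t) (h1 : ∀ t, ρ t ≤ 1)
    (hs : Summable ρ) : Summable fun t => ρ t ^ 2 :=
  Summable.of_nonneg_of_le (fun t => sq_nonneg _)
    (fun t => by rw [sq]; exact mul_le_of_le_one_left (h0 t) (h1 t)) hs

/-- **In the Gaussian model the squared observable decorrelates at least as fast**:
`τ_int(ρ²) ≤ τ_int(ρ)` whenever `0 ≤ ρ ≤ 1` and `ρ` is summable. -/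
theorem tauInt_sq_le {ρ : ℕ → ℝ} (h0 : ∀ t, 0 ≤ ρ t) (h1 : ∀ t, ρ t ≤ 1) (hs : Summable ρ) :
    tauInt (fun t => ρ t ^ 2) ≤ tauInt ρ := by
  unfold tauInt
  have hs1 : Summable fun t => ρ (t + 1) := (summable_nat_add_iff 1).2 hs
  have hs2 : Summable fun t => ρ (t + 1) ^ 2 :=
    (summable_nat_add_iff 1).2 (summable_sq_of_nonneg_le_one h0 h1 hs)
  have hle : ∑' t, ρ (t + 1) ^ 2 ≤ ∑' t, ρ (t + 1) :=
    Summable.tsum_le_tsum (fun t => by rw [sq]; exact mul_le_of_le_one_left (h0 _) (h1 _)) hs2 hs1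
  have e : (∑' t, (fun t => ρ t ^ 2) (t + 1)) = ∑' t, ρ (t + 1) ^ 2 := rfl
  rw [e]
  linarith

end Compare

/-! ## §3 C-1: `ρ(t) = r^t` -/

section Geometric

/-- On C-1 the squared observable is again C-1 with ratio `r²`:
`τ_int(ρ²) = (1 + r²)/(2 (1 − r²))` for `|r| < 1`. -/
theorem tauInt_sq_geometric {r : ℝ} (hr : |r| < 1) :
    tauInt (fun t => (r ^ t) ^ 2) = (1 + r ^ 2) / (2 * (1 - r ^ 2)) := by
  have e : (fun t : ℕ => (r ^ t) ^ 2) = fun t => (r ^ 2) ^ t := funext fun t => by ring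
  rw [e]
  have hr2 : |r ^ 2| < 1 := by
    rw [abs_pow]; exact pow_lt_one₀ (abs_nonneg r) hr two_ne_zero
  exact tauInt_geometric hr2

/-- **`½ τ_int(ρ) ≤ τ_int(ρ²) ≤ τ_int(ρ)` on C-1** (`0 ≤ r < 1`): the ratio
`τ_int(ρ²)/τ_int(ρ) = (1 + r²)/(1 + r)²` lies in `[½, 1]`. -/
theorem half_tauInt_le_tauInt_sq_geometric {r : ℝ} (hr0 : 0 ≤ r) (hr1 : r < 1) :
    tauInt (fun t => r ^ t) / 2 ≤ tauInt (fun t => (r ^ t) ^ 2)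
      ∧ tauInt (fun t => (r ^ t) ^ 2) ≤ tauInt (fun t => r ^ t) := by
  have hr : |r| < 1 := abs_lt.2 ⟨by linarith, hr1⟩
  rw [tauInt_sq_geometric hr, tauInt_geometric hr]
  have h1 : 0 < 1 - r := by linarith
  have h2 : 0 < 1 - r ^ 2 := by nlinarith
  have h3 : 0 < 1 + r := by linarith
  constructor
  · rw [div_div, div_le_div_iff₀ (by positivity) (by positivity)]
    nlinarith [sq_nonneg (1 - r), mul_pos h1 h3]
  · rw [div_le_div_iff₀ (by positivity) (by positivity)]
    nlinarith [sq_nonneg r, mul_pos h1 h3, hr0]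

/-- The ratio in closed form: `τ_int(ρ²)/τ_int(ρ) = (1 + r²)/(1 + r)²` on C-1 (`|r| < 1`). -/
theorem tauInt_sq_div_tauInt_geometric {r : ℝ} (hr : |r| < 1) :
    tauInt (fun t => (r ^ t) ^ 2) / tauInt (fun t => r ^ t) = (1 + r ^ 2) / (1 + r) ^ 2 := by
  rw [tauInt_sq_geometric hr, tauInt_geometric hr]
  have h1 : (1 : ℝ) - r ≠ 0 := by have := (abs_lt.1 hr).2; linarith
  have h3 : (1 : ℝ) + r ≠ 0 := by have := (abs_lt.1 hr).1; linarith
  have h2 : (1 : ℝ) - r ^ 2 = (1 - r) * (1 + r) := by ring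
  rw [h2]
  field_simp

end Geometric

end Summit.Ventures.LatticeQCDFlow.Scoring

end
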